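import Literature.MathematicalPhysics.QuantumFieldTheory.Balaban1983to89.BlockAveragingEMLProp2
import Literature.MathematicalPhysics.QuantumFieldTheory.Balaban1983to89.T4AvgSensitivity
import Literature.MathematicalPhysics.QuantumFieldTheory.Balaban1983to89.T3UnitLawDensityEML
import HarnessLib

/-!
# S1a · THE CENTRE OF THE ONE-STEP FIBRE OVER AN (E)-GOOD DATUM: backgrounds NEST along the hierarchy, and the background's own average sits on the NEXT
# plateau with room ([Balaban1985Averaging] Prop. 2 (53), lit ✓`BlockAveragingEMLProp2`) — the deterministic skeleton of the one-step letters `(L_i)` of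
# ✓`…S1aDomBGOfOneStepLetters` (their targets meet every good fibre), i.e. (E) «BACKGROUND WINDOWS» REPAIRS UV3-NODE §69.17's EMPTY-FIBRE NO-GO, BY KERNEL

Cell `ym3-torus` (YM ladder rung R3 = continuum `SU(2)` Yang–Mills on the three-torus — a RUNG: NOT d = 4, NOT infinite volume, NOT a mass gap, NOT Clay).
Width seat «width 8» `ym3-torus-px8` (gen 26), FREE px helper on crux `stmt-QuantumFields-20520`, count-neutral, DEFINITION-FREE, default heartbeats.  FILE 3 of the seat.

WHY.  UV3-NODE §69.17 (this lineage, GUIDANCE): with windows on the DATUM, the one-step fibre over a rough `2θ_j`-window datum has NO point inside the cut plateau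
`{sfCut_{j+1} = 1}` at `L = 3` — the letter `hdom_j` died there and repair (E) «windows on the BACKGROUND» was adopted (LEAD RULING №60∕№61, ★★OWNER №105; v19.0).  Under (E)
a datum `V` at height `j` is good when it admits a regular minimiser `U₀` (lit `Setup.IsBackground` for the (0.4) averaging `blockAvg ℰp` within `{PlaqSmall R₀}`, `K − j`
averagings above `V`) whose FINEST plaquettes are `< θ_j·L^{−2(K−j)}` ([Balaban1985UV3] (47) p.267: `χ_k` windows `U_k(V)`).  FILES 1–2 (✓p832521, FILE 2) reduced the
cut-height letter `hdomBG_j` to ONE-STEP letters whose targets `T_{i+1}` (plateau ∩ good data one height up) must carry the conditional mass of the fibre over a good datum.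
THIS FILE proves the deterministic half of that picture, by kernel and uniformly in the depth: the fibre over an (E)-good datum is NEVER empty of good plateau points — it
contains the distinguished point `W := Ū^{K−j−1} U₀` (the background's own average one height up), `U₀` is a background OF `W` (backgrounds nest — order theory), `U₀` is in
the next height's background window as soon as `θ_j ≤ L²θ_{j+1}`, and EVERY plaquette of `W` is within `2θ_j∕L²` of `1` ([Balaban1985Averaging] Prop. 2 (53) at `α₀ := θ_j∕L²`,
PROVED in the tree: lit ✓`BlockAveragingEMLProp2.plaqSmall_iter_blockAvg_eml_level`, uniform in the number of averagings) — hence on the plateau `{max dist1 ≤ θ_{j+1}∕2}` when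
`4θ_j ≤ L²θ_{j+1}` (at `L = 3`: `θ_j∕θ_{j+1} ≤ 9∕4`, against the schedule's `≈ √3·(p-ratio) ≤ 1.73…` — §69.17-A (4)'s margin, now a kernel inequality on letters).

WHAT (0 `def`, 0 `sorry`; nothing of Bałaban's renormalisation-group analysis asserted).
§1 (any torus, group, averaging, class) `iter_add_eq_of_iter_eq` (lit ✓`T4AvgSensitivity.iter_add`); ★★`isBackground_iter_of_isBackground` — BACKGROUNDS NEST: a minimiser over
   `reg ∩ {Ū^{k+n} = V}` minimises over `reg ∩ {Ū^k = Ū^k U₀}` (uniqueness-free; [Balaban1987RG1] (1.1) p.260 read for minimisers — cf. the pub-ymgap cell's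
   ✓`BalabanUVNodesN09HierarchyBindersOfLevelwiseThm1.isBackground_restrict_of_minimiser_mem`, which needs a second minimiser; here `reg₁ = reg₂`); `fibreCentre_isBackground`.
§2 (`SU(N)`, any torus) `window_rescale`; ★★`plaqSmall_iter_of_fine_window` — `PlaqSmall (θ·L^{−2(k+1)}) U₀ ⇒ PlaqSmall (2θ∕L²) (Ū^k U₀)` under Prop. 2's two numeric side
   conditions on `α₀ = θ∕L²` (`C₀α₀ ≤ ⅓`, `2α₀ ≤ 2δ_N∕((d+4)L)²`).
§3 (the T³ runs, `blockAvg ℰp`, `SU(2)`) ★★★`fibreCentre_of_goodDatum` (depth `k+1`): (i) `blockAvg ℰp W = V`, (ii) `IsBackground … k W U₀`, (iii) `PlaqSmall (θ′·L^{−2k}) U₀` if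
   `θ ≤ L²θ′`, (iv) `PlaqSmall (2θ∕L²) W`; ★★★`fibreCentre_of_goodDatum_height` — the same in the tower door's indexing (`V : GaugeField (F.P K) (K − j)`, `j < K`, conclusions at
   `K − (j+1)`, re-indexed through the `V`-free form of minimality); ★★`fibreCentre_on_plateau` — under `4θ ≤ L²θ′`: `max_p dist1 (W(∂p)) ≤ θ′∕2` (the plateau of `sfCut θ′`) and
   `PlaqSmall θ′ W`.

HONEST: order theory + one PROVED Literature proposition, instantiated; the numeric side conditions are hypotheses on `θ` (they hold for `j ≥ j₀` since `θBal_j → 0`, cf.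
✓`…S1aCutStepContinuousDensity.exists_cutStep_numerics`); the one-step letters `(L_i)` ∕ transport letters remain HYPOTHESES (this is their `η = 0` skeleton at ONE point of
the fibre, not a concentration bound); `hdomBG_j` NOT discharged; (m) AS TYPED suspect-false at `L = 3` (RULING №105), (m)_E OPEN; (α) UNINHABITED; the five registered stubs
(3732b7df) ∕ 20520 ∕ 19936 ∕ 19200 ∕ `YM3TorusSU2` NOT proved; rung R3 = SU(2) YM₃ on T³ — NOT d = 4, NOT infinite volume, NOT a mass gap, NOT Clay.
References: [Balaban1985Averaging] CMP 98 (1985) Prop. 2 (52)–(54) p.26; [Balaban1987RG1] CMP 109 (1987) (0.11) p.253, (1.1) p.260; [Balaban1985UV3] CMP 102 (1985) (47) p.267;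
[Balaban1985Variational] CMP 102 (1985) Thm 1 (8) p.279.
-/

set_option autoImplicit false

noncomputable section

namespace Summit.QuantumFields.YangMills.Theorems.FluctuationComparisonRegPrIntLS1aFibreCentreOfGoodDatum

open Literature.MathematicalPhysics.QuantumFieldTheory.Balaban1983to89
open T3ContinuumYM3Torus T3UnitLawDensityEML
open Literature.MathematicalPhysics.QuantumFieldTheory.Balaban1983to89.T4AvgSensitivity (iterFrom iter_add)
open Literature.MathematicalPhysics.QuantumFieldTheory.Balaban1983to89.BlockAveragingEMLProp2 (plaqSmall_iter_blockAvg_eml_level)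
open Literature.MathematicalPhysics.QuantumFieldTheory.Balaban1983to89.ExpMeanLog (expMeanLogSU deltaSU)

/-! ## §1 Backgrounds NEST along the hierarchy (order theory; any torus, group, averaging, regularity class) -/

section Nest

variable {P : Params} {G : Type*} [GaugeGroup G]

/-- Two fine fields with the same `k`-fold average have the same `(k+n)`-fold average (lit ✓`T4AvgSensitivity.iter_add`). [cite: Balaban1987RG1, (0.11) p.253] -/
theorem iter_add_eq_of_iter_eq (av : ∀ j, Averaging P j G) {k : ℕ} (n : ℕ) {U U' : GaugeField P 0 G}
    (h : Averaging.iter av k U = Averaging.iter av k U') : Averaging.iter av (k + n) U = Averaging.iter av (k + n) U' := by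
  rw [iter_add av k n U, iter_add av k n U', h]

/-- ★★ **BACKGROUNDS NEST**: if `U₀` minimises the Wilson action over `reg ∩ {Ū^{k+n} = V}` (lit `Setup.IsBackground`), then `U₀` minimises it over
`reg ∩ {Ū^{k} = Ū^{k}U₀}` — the minimiser over a datum is the minimiser over each of its OWN intermediate averages (every competitor of the finer problem is a
competitor of the coarser one: `Ū^k U = Ū^k U₀ ⇒ Ū^{k+n} U = Ū^{k+n} U₀ = V`).  Uniqueness-free; [Balaban1987RG1] (1.1) p.260 read for minimisers.
[cite: Balaban1987RG1, (1.1) p.260; Balaban1985Variational, Thm 1 (8) p.279] -/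
theorem isBackground_iter_of_isBackground {av : ∀ j, Averaging P j G} {reg : Set (GaugeField P 0 G)} {k n : ℕ}
    {V : GaugeField P (k + n) G} {U₀ : GaugeField P 0 G} (h : IsBackground av reg (k + n) V U₀) :
    IsBackground av reg k (Averaging.iter av k U₀) U₀ :=
  ⟨rfl, h.2.1, fun U hU hUk => h.2.2 U hU ((iter_add_eq_of_iter_eq av n hUk).trans h.1)⟩

/-- The one-step case: the background's own `k`-fold average `W := Ū^k U₀` lies in the ONE-STEP fibre over the datum `V = Ū^{k+1} U₀` (`avg_k W = V`) and `U₀`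
is a background of `W`. [cite: Balaban1987RG1, (0.11) p.253 and (1.1) p.260] -/
theorem fibreCentre_isBackground {av : ∀ j, Averaging P j G} {reg : Set (GaugeField P 0 G)} {k : ℕ}
    {V : GaugeField P (k + 1) G} {U₀ : GaugeField P 0 G} (h : IsBackground av reg (k + 1) V U₀) :
    (av k).avg (Averaging.iter av k U₀) = V ∧ IsBackground av reg k (Averaging.iter av k U₀) U₀ :=
  ⟨h.1, isBackground_iter_of_isBackground h⟩

end Nest

/-! ## §2 The centre's plaquettes: [Balaban1985Averaging] Prop. 2 (53) for the (0.4) averaging (lit ✓`BlockAveragingEMLProp2`, PROVED there) -/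

section Centre

variable {n : Type*} [Fintype n] [DecidableEq n] [Nonempty n] {P : Params}

/-- Window bookkeeping: `θ·(L⁻¹)^{2(k+1)} = (θ∕L²)·((L^k)⁻¹)²`. [folklore] -/
theorem window_rescale (L θ : ℝ) (k : ℕ) :
    θ * (L⁻¹) ^ (2 * (k + 1)) = θ / L ^ 2 * ((L ^ k)⁻¹) ^ 2 := by
  rw [div_eq_mul_inv, ← inv_pow, ← inv_pow]
  ring

/-- ★★ **THE CENTRE OF THE FIBRE IS ON THE NEXT WINDOW WITH ROOM**: if the finest field `U₀` has every plaquette within `θ·L^{−2(k+1)}` of `1` (the (E) background window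
of a height with `k+1` averagings above it), then its `k`-fold (0.4) average `Ū^k U₀` has every plaquette within `2θ∕L²` of `1` — [Balaban1985Averaging] Prop. 2 (53) at
`α₀ := θ∕L²` (lit ✓`plaqSmall_iter_blockAvg_eml_level`, uniform in `k`), under its two printed numeric side conditions on `α₀`. [cite: Balaban1985Averaging, Prop. 2 (52)-(54) p.26] -/
theorem plaqSmall_iter_of_fine_window (k : ℕ) {θ : ℝ} (hθ : 0 < θ)
    (hα3 : (143 * ((((P.d + 4 : ℕ) : ℝ)) ^ 2 / 4) ^ 2) * (θ / (P.L : ℝ) ^ 2) ≤ 1 / 3)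
    (hα2 : 2 * (θ / (P.L : ℝ) ^ 2) ≤ 2 * deltaSU n / (((P.d + 4) * P.L : ℕ) : ℝ) ^ 2)
    {U₀ : GaugeField P 0 (Matrix.specialUnitaryGroup n ℂ)} (h : PlaqSmall (θ * ((P.L : ℝ)⁻¹) ^ (2 * (k + 1))) U₀) :
    PlaqSmall (2 * (θ / (P.L : ℝ) ^ 2)) (Averaging.iter (fun _ => BlockAveraging.blockAvg (expMeanLogSU (n := n))) k U₀) := by
  have hL : (0 : ℝ) < P.L := by exact_mod_cast P.L_pos
  have hα : 0 < θ / (P.L : ℝ) ^ 2 := div_pos hθ (pow_pos hL 2)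
  have h52 : PlaqSmall (θ / (P.L : ℝ) ^ 2 * (((P.L : ℝ) ^ k)⁻¹) ^ 2) U₀ := by
    rw [← window_rescale (P.L : ℝ) θ k]; exact h
  have hLk : (P.L : ℝ) ^ k * ((P.L : ℝ) ^ k)⁻¹ = 1 := mul_inv_cancel₀ (pow_ne_zero k hL.ne')
  have := plaqSmall_iter_blockAvg_eml_level (n := n) k hα hα3 hα2 h52 (j := k) le_rfl
  rwa [hLk, one_pow, mul_one] at this

end Centre

/-! ## §3 Assembled in the letters of the (m)_E node: the centre of the one-step fibre over an (E)-good datum of run `K` -/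

section Assembled

variable (F : T3Family)

/-- ★★★ **THE CENTRE OF THE ONE-STEP FIBRE OVER AN (E)-GOOD DATUM IS (E)-GOOD ONE HEIGHT UP AND SITS ON THE NEXT PLATEAU — BY KERNEL.**  Run `K`, a height with
`k+1` averagings above it, a datum `V` there with an (E) background `U₀` (lit `IsBackground` for the (0.4) averaging `blockAvg ℰp` within `{PlaqSmall R₀}`, fine window
`θ·L^{−2(k+1)}`).  Let `W := Ū^k U₀` (one height up).  THEN: (i) `W` lies in the one-step fibre over `V` (`blockAvg ℰp W = V`); (ii) `U₀` is a background of `W` (§1: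
backgrounds nest); (iii) `U₀` is inside the NEXT height's (E) background window `θ′·L^{−2k}` as soon as `θ ≤ L²·θ′`; (iv) every plaquette of `W` is within `2θ∕L²` of `1`
(§2) — so `W` is on the next cut plateau `{max dist1 ≤ θ′∕2}` whenever `4θ ≤ L²θ′`, and in the next datum window whenever `2θ < L²θ′`.  CONTRAST UV3-NODE §69.17: for the
line's DATUM windows the one-step fibre over a rough window datum has NO point on the plateau at `L = 3`; under (E) «BACKGROUND WINDOWS» the fibre over every good datum
contains the background's own average, with room — the deterministic skeleton of the one-step letters `(L_i)` of ✓`…S1aDomBGOfOneStepLetters` (their `T_{i+1} ∩ fibre(V) ≠ ∅`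
at every good `V`).  Numeric side conditions = [Balaban1985Averaging] Prop. 2's, on `α₀ := θ∕L²`.  Nothing of Bałaban's RG analysis asserted.
[cite: Balaban1985Averaging, Prop. 2 (52)-(54) p.26; Balaban1987RG1, (1.1) p.260; Balaban1985UV3, (47) p.267] -/
theorem fibreCentre_of_goodDatum (K k : ℕ) {θ θ' R₀ : ℝ} (hθ : 0 < θ) (hθθ' : θ ≤ (F.L : ℝ) ^ 2 * θ')
    (hα3 : (143 * (((((F.P K).d + 4 : ℕ) : ℝ)) ^ 2 / 4) ^ 2) * (θ / ((F.P K).L : ℝ) ^ 2) ≤ 1 / 3)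
    (hα2 : 2 * (θ / ((F.P K).L : ℝ) ^ 2) ≤ 2 * deltaSU (Fin 2) / ((((F.P K).d + 4) * (F.P K).L : ℕ) : ℝ) ^ 2)
    {V : GaugeField (F.P K) (k + 1) ↥(Matrix.specialUnitaryGroup (Fin 2) ℂ)} {U₀ : GaugeField (F.P K) 0 ↥(Matrix.specialUnitaryGroup (Fin 2) ℂ)}
    (hbg : IsBackground (fun i => BlockAveraging.blockAvg (P := F.P K) (j := i) ℰp) {U | PlaqSmall R₀ U} (k + 1) V U₀)
    (hsm : PlaqSmall (θ * ((F.L : ℝ)⁻¹) ^ (2 * (k + 1))) U₀) :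
    (BlockAveraging.blockAvg (P := F.P K) (j := k) ℰp).avg (Averaging.iter (fun i => BlockAveraging.blockAvg (P := F.P K) (j := i) ℰp) k U₀) = V ∧
      IsBackground (fun i => BlockAveraging.blockAvg (P := F.P K) (j := i) ℰp) {U | PlaqSmall R₀ U} k
        (Averaging.iter (fun i => BlockAveraging.blockAvg (P := F.P K) (j := i) ℰp) k U₀) U₀ ∧
      PlaqSmall (θ' * ((F.L : ℝ)⁻¹) ^ (2 * k)) U₀ ∧
      PlaqSmall (2 * (θ / (F.L : ℝ) ^ 2)) (Averaging.iter (fun i => BlockAveraging.blockAvg (P := F.P K) (j := i) ℰp) k U₀) := by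
  have hL : (1 : ℝ) < F.L := by exact_mod_cast F.hL.2
  have hL0 : (0 : ℝ) < F.L := by linarith
  refine ⟨hbg.1, isBackground_iter_of_isBackground hbg, ?_, ?_⟩
  · -- (iii) the next height's background window: θ·L^{-2(k+1)} ≤ θ′·L^{-2k}
    intro p
    refine (hsm p).trans_le ?_
    have e : θ * ((F.L : ℝ)⁻¹) ^ (2 * (k + 1)) = θ / (F.L : ℝ) ^ 2 * ((F.L : ℝ)⁻¹) ^ (2 * k) := by
      rw [show 2 * (k + 1) = 2 * k + 2 by ring, pow_add, inv_pow, inv_pow, div_eq_mul_inv]; ring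
    rw [e]
    refine mul_le_mul_of_nonneg_right ?_ (pow_nonneg (inv_nonneg.mpr hL0.le) _)
    rw [div_le_iff₀ (pow_pos hL0 2)]
    linarith [mul_comm ((F.L : ℝ) ^ 2) θ']
  · -- (iv) Prop. 2 (53) at α₀ = θ/L²
    exact plaqSmall_iter_of_fine_window (P := F.P K) (n := Fin 2) k hθ hα3 hα2 hsm

/-- ★★★ **THE SAME IN THE TOWER DOOR's HEIGHT INDEXING** (`V : GaugeField (F.P K) (K − j)`, `j < K`; conclusions at `K − (j+1)`): from the (E)-good witness `U₀` of a
height-`j` datum (lit `IsBackground … (K − j) V U₀` + fine window `θ·L^{−2(K−j)}`), its `(K−(j+1))`-fold average `W` (one height up, in the one-step fibre over `V`: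
`Ū^{K−j} U₀ = V`) has `U₀` as a background, `U₀` lies in the height-`(j+1)` background window `θ′·L^{−2(K−(j+1))}` when `θ ≤ L²θ′`, and `W` is `2θ∕L²`-plaquette-small.
[cite: Balaban1985Averaging, Prop. 2 (52)-(54) p.26; Balaban1987RG1, (1.1) p.260; Balaban1985UV3, (47) p.267] -/
theorem fibreCentre_of_goodDatum_height (K j : ℕ) (hjK : j < K) {θ θ' R₀ : ℝ} (hθ : 0 < θ) (hθθ' : θ ≤ (F.L : ℝ) ^ 2 * θ')
    (hα3 : (143 * (((((F.P K).d + 4 : ℕ) : ℝ)) ^ 2 / 4) ^ 2) * (θ / ((F.P K).L : ℝ) ^ 2) ≤ 1 / 3)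
    (hα2 : 2 * (θ / ((F.P K).L : ℝ) ^ 2) ≤ 2 * deltaSU (Fin 2) / ((((F.P K).d + 4) * (F.P K).L : ℕ) : ℝ) ^ 2)
    {V : GaugeField (F.P K) (K - j) ↥(Matrix.specialUnitaryGroup (Fin 2) ℂ)} {U₀ : GaugeField (F.P K) 0 ↥(Matrix.specialUnitaryGroup (Fin 2) ℂ)}
    (hbg : IsBackground (fun i => BlockAveraging.blockAvg (P := F.P K) (j := i) ℰp) {U | PlaqSmall R₀ U} (K - j) V U₀)
    (hsm : PlaqSmall (θ * ((F.L : ℝ)⁻¹) ^ (2 * (K - j))) U₀) :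
    Averaging.iter (fun i => BlockAveraging.blockAvg (P := F.P K) (j := i) ℰp) (K - j) U₀ = V ∧
      IsBackground (fun i => BlockAveraging.blockAvg (P := F.P K) (j := i) ℰp) {U | PlaqSmall R₀ U} (K - (j + 1))
        (Averaging.iter (fun i => BlockAveraging.blockAvg (P := F.P K) (j := i) ℰp) (K - (j + 1)) U₀) U₀ ∧
      PlaqSmall (θ' * ((F.L : ℝ)⁻¹) ^ (2 * (K - (j + 1)))) U₀ ∧
      PlaqSmall (2 * (θ / (F.L : ℝ) ^ 2)) (Averaging.iter (fun i => BlockAveraging.blockAvg (P := F.P K) (j := i) ℰp) (K - (j + 1)) U₀) := by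
  refine ⟨hbg.1, ?_⟩
  -- the `V`-free form of the minimality, then re-index `K − j = (K − (j+1)) + 1`
  have hreg : U₀ ∈ {U : GaugeField (F.P K) 0 ↥(Matrix.specialUnitaryGroup (Fin 2) ℂ) | PlaqSmall R₀ U} := hbg.2.1
  have hmin : ∀ U ∈ {U : GaugeField (F.P K) 0 ↥(Matrix.specialUnitaryGroup (Fin 2) ℂ) | PlaqSmall R₀ U},
      Averaging.iter (fun i => BlockAveraging.blockAvg (P := F.P K) (j := i) ℰp) (K - j) U =
        Averaging.iter (fun i => BlockAveraging.blockAvg (P := F.P K) (j := i) ℰp) (K - j) U₀ → wilsonAction4 U₀ ≤ wilsonAction4 U :=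
    fun U hU hUe => hbg.2.2 U hU (hUe.trans hbg.1)
  have hk : K - j = K - (j + 1) + 1 := by omega
  rw [hk] at hmin hsm
  have hbg' : IsBackground (fun i => BlockAveraging.blockAvg (P := F.P K) (j := i) ℰp) {U | PlaqSmall R₀ U} (K - (j + 1) + 1)
      (Averaging.iter (fun i => BlockAveraging.blockAvg (P := F.P K) (j := i) ℰp) (K - (j + 1) + 1) U₀) U₀ := ⟨rfl, hreg, hmin⟩
  exact (fibreCentre_of_goodDatum F K (K - (j + 1)) hθ hθθ' hα3 hα2 hbg' hsm).2

/-- ★★ **COROLLARY — THE CENTRE IS ON THE NEXT PLATEAU AND IN THE NEXT DATUM WINDOW**: under `4θ ≤ L²θ′` every plaquette of the centre `W` is within `θ′∕2` of `1`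
(the plateau `{sfCut θ′ = 1}` of the line's cut), and under `2θ < L²θ′` the centre is `θ′`-plaquette-small (the next datum window). [cite: Balaban1985Averaging, Prop. 2 (54) p.26; Balaban1985UV3, (47) p.267] -/
theorem fibreCentre_on_plateau (K k : ℕ) {θ θ' R₀ : ℝ} (hθ : 0 < θ) (h4 : 4 * θ ≤ (F.L : ℝ) ^ 2 * θ')
    (hα3 : (143 * (((((F.P K).d + 4 : ℕ) : ℝ)) ^ 2 / 4) ^ 2) * (θ / ((F.P K).L : ℝ) ^ 2) ≤ 1 / 3)
    (hα2 : 2 * (θ / ((F.P K).L : ℝ) ^ 2) ≤ 2 * deltaSU (Fin 2) / ((((F.P K).d + 4) * (F.P K).L : ℕ) : ℝ) ^ 2)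
    {V : GaugeField (F.P K) (k + 1) ↥(Matrix.specialUnitaryGroup (Fin 2) ℂ)} {U₀ : GaugeField (F.P K) 0 ↥(Matrix.specialUnitaryGroup (Fin 2) ℂ)}
    (hbg : IsBackground (fun i => BlockAveraging.blockAvg (P := F.P K) (j := i) ℰp) {U | PlaqSmall R₀ U} (k + 1) V U₀)
    (hsm : PlaqSmall (θ * ((F.L : ℝ)⁻¹) ^ (2 * (k + 1))) U₀) :
    (∀ p, dist1 (GaugeField.plaqHol (Averaging.iter (fun i => BlockAveraging.blockAvg (P := F.P K) (j := i) ℰp) k U₀) p) ≤ θ' / 2) ∧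
      PlaqSmall θ' (Averaging.iter (fun i => BlockAveraging.blockAvg (P := F.P K) (j := i) ℰp) k U₀) := by
  have hL : (1 : ℝ) < F.L := by exact_mod_cast F.hL.2
  have hL2 : (0 : ℝ) < (F.L : ℝ) ^ 2 := by positivity
  have hθθ' : θ ≤ (F.L : ℝ) ^ 2 * θ' := by nlinarith
  have h := (fibreCentre_of_goodDatum F K k hθ hθθ' hα3 hα2 hbg hsm).2.2.2
  have hw : 2 * (θ / (F.L : ℝ) ^ 2) ≤ θ' / 2 := by
    rw [mul_div_assoc', div_le_iff₀ hL2]; linarith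
  refine ⟨fun p => ((h p).le).trans hw, fun p => (h p).trans_le ?_⟩
  have hθ'0 : 0 < θ' := by nlinarith
  linarith

end Assembled

end Summit.QuantumFields.YangMills.Theorems.FluctuationComparisonRegPrIntLS1aFibreCentreOfGoodDatum

end
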